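import Literature.MathematicalPhysics.QuantumFieldTheory.Balaban1983to89.B14
import Literature.MathematicalPhysics.QuantumFieldTheory.Balaban1983to89.B14RSplit

/-!
# `Balaban1983to89.B14Sect1Scales` — CMP 119 §1 p. 245: the two large-cube partitions of `T₁` (`MR₀`-cubes and
# `LM₂R₀`-cubes), the POWER-OF-`L` side conditions `M = L^m`, `M₂ = L^{m₂}`, `M₁ < M₂ < M` typed WITH BODY, and the
# sentence *"The above partitions have to be compatible"* PROVED from them

statement-level skeleton of published theorems with citation tags; proofs where landed; nothing here is a claim
about the Yang–Mills mass gap.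

CITATION HEADER (lean-in-tree rule).  Source: T. Bałaban, *Convergent renormalization expansions for lattice gauge
theories*, Commun. Math. Phys. **119**, 243–285 (1988), doi:10.1007/bf01217741 [Balaban1988Convergent] (cell paper
B14 = "[III]"; held `paper:balaban1988-cmp119-convergent-renormalization`, journal page = PDF page + 242; p. 245 read
on the x2 render `…-p003-x2.png` and the text layer).  Mega-formalization `lit-balaban`, unit `lit-balaban-r11`
(CMP 119), SKELETON row **B14.Def§1.scales** (the constants record is pre-cell `Setup.Consts` with the ORDER conditions
`Consts.ScalesOrdered`; `R₀` is `B14.IsRj` at `j = 0`; the operation `~` is `B14DomainGeom.enl`; the nesting of `L`-adic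
partitions is r11 gen 1 `B14.RSplit.same_coarse_cube_of_same_fine_cube`).

THE PRINTED TEXT (p. 245, verbatim): *"At first we introduce two additional partitions of the lattice T₁ into large
cubes. The first is a partition into cubes of the size MR₀, where R₀ is the smallest power of L such that
R₀ ≥ (log g₀⁻²)^r, r ≥ 2, and M = L^m is sufficiently large. The second is a partition into cubes of the size LM₂R₀,
where M₂ = L^{m₂}, and M₁ < M₂ < M. Let us recall that M₁ is the size of large cubes for which all the theorems of the
previous papers, especially those concerning the variational problem, are valid. We fix M₂ not too much larger that M₁,
e.g., we can take M₂ = L²M₁, and M will be chosen much larger than M₂. The choice will be dictated by many conditions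
involving this constant. The above partitions have to be compatible, and compatible with the partition π₀ as well, and
with other partitions introduced later."*

WHAT IS TYPED / PROVED.  §1 `PowersOfL L C` — the printed side conditions on the scales of `Setup.Consts` WITH BODY:
`M = L^m`, `M₂ = L^{m₂}` for some naturals `m, m₂`, and `M₁ < M₂ < M` (the order part is also in `Consts.ScalesOrdered`);
print's example *"M₂ = L²M₁"* satisfies them when `M₁` is itself a power of `L` and `L²M₁ < M` (`powersOfL_example`).
§2 the sentence *"The above partitions have to be compatible"* PROVED as what the side conditions buy: with
`R₀ = L^{s}` ((2.5), `B14.IsRj`) the two cube sizes are `LM₂R₀ = L^{m₂+1+s}` and `MR₀ = L^{m+s}` with `m₂ + 1 ≤ m`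
(`exp_succ_le`), so `LM₂R₀ ∣ MR₀` (`fine_dvd_coarse`) and every `LM₂R₀`-cube of the `L`-adic partition of `ℤᵈ` lies in one
`MR₀`-cube (`compatible`: equal fine labels ⇒ equal coarse labels, by `B14.RSplit.same_coarse_cube_of_same_fine_cube`).
Not here: *"M sufficiently large … dictated by many conditions"* (forward pointer), the compatibility with `π₀` and *"other
partitions introduced later"* (pointers; same lemma once their sizes are powers of `L`), the choice of `r`, `p₀`
(`Consts.ScalesOrdered`: `2 ≤ r`, `5r ≤ p₀`, p. 246).  No `sorry`.
-/

namespace Literature.MathematicalPhysics.QuantumFieldTheory.Balaban1983to89.B14.Sect1Scales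

open Literature.MathematicalPhysics.QuantumFieldTheory.Balaban1983to89

/-! ## §1  The power-of-`L` side conditions on the scales -/

/-- **§1 p. 245, the side conditions on the scales**: *"M = L^m … M₂ = L^{m₂}, and M₁ < M₂ < M"* — for the block size
`L` and the constants record `C : Setup.Consts` (fields `M`, `M₁`, `M₂`). [cite: Balaban1988Convergent, §1 p.245] -/
structure PowersOfL (L : ℕ) (C : Consts) : Prop where
  /-- `M = L^m` for some `m`. -/
  M_pow : ∃ m : ℕ, C.M = L ^ m
  /-- `M₂ = L^{m₂}` for some `m₂`. -/
  M₂_pow : ∃ m₂ : ℕ, C.M₂ = L ^ m₂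
  /-- `M₁ < M₂`. -/
  M₁_lt_M₂ : C.M₁ < C.M₂
  /-- `M₂ < M`. -/
  M₂_lt_M : C.M₂ < C.M

/-- The order part of the side conditions is the `M₁ < M₂ < M` clause of `Consts.ScalesOrdered`.
[cite: Balaban1988Convergent, §1 p.245] -/
theorem PowersOfL.order {L : ℕ} {C : Consts} (h : PowersOfL L C) : C.M₁ < C.M₂ ∧ C.M₂ < C.M :=
  ⟨h.M₁_lt_M₂, h.M₂_lt_M⟩

/-- Print's example *"we can take M₂ = L²M₁"*: if `M₁ = L^{m₁}`, `M₂ = L²M₁`, `M = L^m` with `M₂ < M` and `L ≥ 2`, the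
side conditions hold. [cite: Balaban1988Convergent, §1 p.245] -/
theorem powersOfL_example {L : ℕ} (hL : 2 ≤ L) {C : Consts} {m₁ m : ℕ} (hM₁ : C.M₁ = L ^ m₁)
    (hM₂ : C.M₂ = L ^ 2 * C.M₁) (hM : C.M = L ^ m) (hlt : C.M₂ < C.M) : PowersOfL L C where
  M_pow := ⟨m, hM⟩
  M₂_pow := ⟨m₁ + 2, by rw [hM₂, hM₁, ← pow_add, Nat.add_comm]⟩
  M₁_lt_M₂ := by
    rw [hM₂, hM₁]
    have h1 : 1 < L ^ 2 := Nat.one_lt_pow (by norm_num) (by omega)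
    have h2 : 0 < L ^ m₁ := by positivity
    exact lt_mul_left h2 h1
  M₂_lt_M := hlt

/-- From `L^{m₂} = M₂ < M = L^m` (`L ≥ 2`): `m₂ + 1 ≤ m` — the finer size gains at least one factor `L`.
[cite: Balaban1988Convergent, §1 p.245] -/
theorem exp_succ_le {L m m₂ : ℕ} (hL : 2 ≤ L) (h : L ^ m₂ < L ^ m) : m₂ + 1 ≤ m := by
  have := (Nat.pow_lt_pow_iff_right (by omega : 1 < L)).mp h
  omega

/-! ## §2  "The above partitions have to be compatible" -/

/-- The cube sizes: `LM₂R₀ = L^{m₂+1+s}` and `MR₀ = L^{m+s}` when `M = L^m`, `M₂ = L^{m₂}`, `R₀ = L^s`.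
[cite: Balaban1988Convergent, §1 p.245] -/
theorem sizes_pow {L m m₂ s M M₂ R₀ : ℕ} (hM : M = L ^ m) (hM₂ : M₂ = L ^ m₂) (hR : R₀ = L ^ s) :
    L * M₂ * R₀ = L ^ (m₂ + 1 + s) ∧ M * R₀ = L ^ (m + s) := by
  subst hM hM₂ hR
  constructor <;> ring

/-- Hence the finer size divides the coarser: `LM₂R₀ ∣ MR₀` (given `M₂ < M`, `L ≥ 2`).
[cite: Balaban1988Convergent, §1 p.245] -/
theorem fine_dvd_coarse {L m m₂ s M M₂ R₀ : ℕ} (hL : 2 ≤ L) (hM : M = L ^ m) (hM₂ : M₂ = L ^ m₂) (hR : R₀ = L ^ s)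
    (hlt : M₂ < M) : L * M₂ * R₀ ∣ M * R₀ := by
  obtain ⟨h1, h2⟩ := sizes_pow hM hM₂ hR
  rw [h1, h2]
  apply Nat.pow_dvd_pow
  have := exp_succ_le hL (hM ▸ hM₂ ▸ hlt)
  omega

/-- **"The above partitions have to be compatible"** (p. 245) — PROVED from the side conditions: in the `L`-adic
partitions of `ℤᵈ` (cube label of a site `x` for size `N` = `(⌊x_μ/N⌋)_μ`), two sites in the same `LM₂R₀`-cube lie in
the same `MR₀`-cube, for `M = L^m`, `M₂ = L^{m₂}`, `R₀ = L^s` ((2.5)), `M₂ < M`, `L ≥ 2`.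
[cite: Balaban1988Convergent, §1 p.245] -/
theorem compatible {d : ℕ} {L m m₂ s M M₂ R₀ : ℕ} (hL : 2 ≤ L) (hM : M = L ^ m) (hM₂ : M₂ = L ^ m₂)
    (hR : R₀ = L ^ s) (hlt : M₂ < M) {x y : Fin d → ℤ}
    (h : (fun μ => x μ / ((L * M₂ * R₀ : ℕ) : ℤ)) = fun μ => y μ / ((L * M₂ * R₀ : ℕ) : ℤ)) :
    (fun μ => x μ / ((M * R₀ : ℕ) : ℤ)) = fun μ => y μ / ((M * R₀ : ℕ) : ℤ) := by
  obtain ⟨h1, h2⟩ := sizes_pow hM hM₂ hR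
  have hle : m₂ + 1 + s ≤ m + s := by
    have := exp_succ_le hL (hM ▸ hM₂ ▸ hlt)
    omega
  rw [h2, Nat.cast_pow]
  rw [h1, Nat.cast_pow] at h
  exact RSplit.same_coarse_cube_of_same_fine_cube L hle h

/-- The same from the typed side conditions `PowersOfL L C` and (2.5)'s `B14.IsRj L r g₀ R₀` (which makes `R₀` a
power of `L`). [cite: Balaban1988Convergent, §1 p.245] -/
theorem compatible_of_powersOfL {d : ℕ} {L : ℕ} (hL : 2 ≤ L) {C : Consts} (hC : PowersOfL L C) {r : ℕ} {g₀ : ℝ}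
    {R₀ : ℕ} (hR : B14.IsRj L r g₀ R₀) {x y : Fin d → ℤ}
    (h : (fun μ => x μ / ((L * C.M₂ * R₀ : ℕ) : ℤ)) = fun μ => y μ / ((L * C.M₂ * R₀ : ℕ) : ℤ)) :
    (fun μ => x μ / ((C.M * R₀ : ℕ) : ℤ)) = fun μ => y μ / ((C.M * R₀ : ℕ) : ℤ) := by
  obtain ⟨m, hM⟩ := hC.M_pow
  obtain ⟨m₂, hM₂⟩ := hC.M₂_pow
  obtain ⟨s, hs, -, -⟩ := hR
  exact compatible hL hM hM₂ hs hC.M₂_lt_M h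

end Literature.MathematicalPhysics.QuantumFieldTheory.Balaban1983to89.B14.Sect1Scales
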